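import Summits.HodgeConjecture.HodgeConjecture.Theorems.NikulinTwinTransportTwinTwistorTransportOffWallStable
import Summits.HodgeConjecture.HodgeConjecture.Theorems.NikulinTwinTransportTwinTwistorTransportLocPathConnected
import Summits.HodgeConjecture.HodgeConjecture.Theorems.NikulinTwinTransportHodgeSimilitudeAlgebraicAnchors
import Literature.AlgebraicGeometry.Surfaces.K3CMPeriodLattice

/-!
# Route NikulinTwinTransport · crux `TwinTwistorTransport` (stmt-HodgeConjecture-14393) —
# line `reduced-virtual-count-twin-locus`, lead lemmas for the heart `stub_nonzeroReducedClass`: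
# off-wall points exist in every `D_h`; twin transport gives a good pair at every polarised period

Two helper theorems of the line lead (prover-line-stmt-HodgeConjecture-14393-c1-0, cycle 1), serving
the research stub `stub_nonzeroReducedClass` of the skeleton
`Cruxes/TwinTwistorTransport/Lines/reduced_virtual_count_twin_locus.lean` (they are the two inputs of its
kernel-checked tightness theorem `nonzeroReducedClass_iff_crux` there):

* `exists_offWall_mem_polarisedPeriodDomain` — for every rational lattice `2`-similitude `(M, N)`
  (`Latt[M, N]`) and every `h ∈ Λ` with `h² > 0`, the polarised period domain `D_h` contains a point
  lying on NO wall of the `h`-polarised `M`-twin family (neither `δ^⊥` for a root `δ ⊥ h`, nor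
  `(Mδ′)^⊥` for a root `δ′` with `Mδ′ ⊥ h`). Proof (Huybrechts Ch. 7 §3.1 genericity trick run inside
  `h^⊥`): `a := n + ε g_h` with `n ⊥ h` positive, `g_h` the projection to `h^⊥` of a vector `g` with
  `g^⊥ ∩ Λ = 0` (`exists_k3_genericVector`), `ε` small and outside a countable set; then no non-zero
  lattice vector orthogonal to `h` is orthogonal to `a`; complete to `b ⊥ a, h`, `(b.b) = (a.a)`, in a
  positive three-space; `x₀ := a + ib`; a wall vector through `x₀` (`δ`, resp. `d·Mδ′` with `d` a
  common denominator of `M`, `twinLatt_exists_common_denominator`) would vanish.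
* `goodPairAt_of_twinTransport` — granted the surjectivity of the period map (`K3PeriodSurjective`,
  route crux stmt-HodgeConjecture-15154), `TwinTransportFor[M]` gives a GOOD marked `M`-twin pair
  with first period `x` at every `x ∈ D_h` (realise `x` and the twin period `N x` — `periodPt_simil`,
  `N` is a rational `½`-similitude — and transport).

No definitions, no named facts; local notations verbatim from the line skeleton.

## References
* [Huybrechts2016K3] D. Huybrechts, Lectures on K3 Surfaces, CUP 2016, Ch. 6 §1.1, Rem. 1.6, §2.4;
  Ch. 7 §3.1; Ch. 8 §2.2 Rem. 2.2.
-/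

noncomputable section

set_option linter.dupNamespace false

open CategoryTheory MonoidalCategory
open Literature.AlgebraicGeometry.Motives Literature.AlgebraicGeometry.HodgeTheory
open Literature.AlgebraicGeometry.Surfaces
open Literature.AlgebraicTopology.SingularHomology
open Summit.HodgeConjecture.HodgeConjecture.Theses.NikulinTwinTransport
open Summit.HodgeConjecture.HodgeConjecture.Theorems.NikulinSerreCarrier.NeronSeveriIntertwiner
  (k3Real_orthogonal_re_im)

namespace Summit.HodgeConjecture.HodgeConjecture.Theorems.NikulinTwinTransport

/-! ### Local notations — verbatim the notation blocks of the line skeleton (Theorems files carry no defs) -/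

local notation3 (prettyPrint := false) "MarkedK3[" S ", " η ", " p ", " x "]" =>
  (IsIntegralClass p ∧
    (∀ q : complexBetti S (2 * 2), IsIntegralClass q → ∃ n : ℤ, q = n • p) ∧
    (∀ c : complexBetti S (2 * 1), IsIntegralClass c ↔ ∃ v : K3Index → ℤ, η c = fun i => (v i : ℂ)) ∧
    (∀ a b : complexBetti S (2 * 1),
        cupProduct (rfl : 2 * 1 + 2 * 1 = 2 * 2) a b = k3Form (η a) (η b) • p) ∧
    IsOfHodgeType 2 S (2 * 1) 2 0 (LinearEquiv.symm η x) ∧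
    (∀ τ : complexBetti S (2 * 1), IsOfHodgeType 2 S (2 * 1) 2 0 τ → ∃ t : ℂ, τ = t • LinearEquiv.symm η x))

local notation3 (prettyPrint := false) "PeriodPt[" x "]" =>
  (k3Form x x = 0 ∧ 0 < (k3Form (star x) x).re ∧
    ∃ u : K3Index → ℤ, k3Form (fun i => (u i : ℂ)) x = 0 ∧ 0 < ∑ i, ∑ j, u i * k3Gram i j * u j)

local notation3 (prettyPrint := false) "Corr[" μ ", " S ", " S' ", " hS ", " hS' " ; " γ ", " y "]" =>
  complexGysin μ
    (IsSmoothProjective.tensor_holds (IsK3Surface.isSmoothProjective hS)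
      (IsK3Surface.isSmoothProjective hS'))
    (IsK3Surface.isSmoothProjective hS) (SemiCartesianMonoidalCategory.fst S S')
    (rfl : 2 * 1 + 2 * 2 + 2 * 2 = 2 * 1 + 2 * (2 + 2))
    (cupProduct (rfl : 2 * 1 + 2 * 2 = 2 * 1 + 2 * 2)
      (complexBetti.map (SemiCartesianMonoidalCategory.snd S S') (2 * 1) y) γ)

local notation3 (prettyPrint := false) "TwinTransportFor[" M "]" =>
  ∀ (μ : OrientationFamily), μ.HasPoincareDuality →
    ∀ (S S' : SchemeOver ℂ) (hS : IsK3Surface S) (hS' : IsK3Surface S')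
      (η : complexBetti S (2 * 1) ≃ₗ[ℂ] (K3Index → ℂ)) (p : complexBetti S (2 * 2))
      (x : K3Index → ℂ)
      (η' : complexBetti S' (2 * 1) ≃ₗ[ℂ] (K3Index → ℂ)) (p' : complexBetti S' (2 * 2))
      (x' : K3Index → ℂ),
      MarkedK3[S, η, p, x] → PeriodPt[x] → MarkedK3[S', η', p', x'] → PeriodPt[x'] →
      (∃ t : ℂ, M x' = t • x) →
      ∃ γ ∈ algebraicClasses (MonoidalCategoryStruct.tensorObj S S') 2,
        ∀ y : complexBetti S' (2 * 1), η.symm (M (η' y)) = Corr[μ, S, S', hS, hS' ; γ, y]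

/-- `Latt[M, N]`: `M` is a rational `2`-similitude of `(Λ_ℂ, k3Form)` with rational two-sided inverse `N`
(verbatim the conclusion of `exists_twoSimilitude_k3Lattice`). -/
local notation3 (prettyPrint := false) "Latt[" M ", " N "]" =>
  ((∀ v : K3Index → ℤ, ∃ w : K3Index → ℚ, M (fun i => (v i : ℂ)) = fun i => (w i : ℂ)) ∧
    (∀ v : K3Index → ℤ, ∃ w : K3Index → ℚ, N (fun i => (v i : ℂ)) = fun i => (w i : ℂ)) ∧
    M * N = 1 ∧ N * M = 1 ∧
    (∀ a b, k3Form (M a) (M b) = 2 * k3Form a b))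

/-- `Good[M, μ, S, S', hS, hS', η, η']`: the twin similitude `η⁻¹ ∘ M ∘ η'` is induced by an algebraic class. -/
local notation3 (prettyPrint := false) "Good[" M ", " μ ", " S ", " S' ", " hS ", " hS' ", " η ", " η' "]" =>
  ∃ γ ∈ algebraicClasses (MonoidalCategoryStruct.tensorObj S S') 2,
    ∀ y : complexBetti S' (2 * 1), (η : complexBetti S (2 * 1) ≃ₗ[ℂ] (K3Index → ℂ)).symm
      (M ((η' : complexBetti S' (2 * 1) ≃ₗ[ℂ] (K3Index → ℂ)) y)) = Corr[μ, S, S', hS, hS' ; γ, y]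

/-- `GoodPairAt[M, μ, x]`: SOME marked projective `M`-twin pair with first period `x` has an
algebraic twin similitude. -/
local notation3 (prettyPrint := false) "GoodPairAt[" M ", " μ ", " x "]" =>
  ∃ (S S' : SchemeOver ℂ) (hS : IsK3Surface S) (hS' : IsK3Surface S')
    (η : complexBetti S (2 * 1) ≃ₗ[ℂ] (K3Index → ℂ)) (p : complexBetti S (2 * 2))
    (η' : complexBetti S' (2 * 1) ≃ₗ[ℂ] (K3Index → ℂ)) (p' : complexBetti S' (2 * 2))
    (x' : K3Index → ℂ),
    MarkedK3[S, η, p, x] ∧ PeriodPt[x] ∧ MarkedK3[S', η', p', x'] ∧ PeriodPt[x'] ∧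
    (∃ t : ℂ, M x' = t • x) ∧ Good[M, μ, S, S', hS, hS', η, η']

/-- `OffWall[M, h, x]`: the period `x` lies on none of the `(−2)`-WALLS of the `h`-polarised `M`-twin family —
no root `δ ∈ Λ` (`δ² = −2`) orthogonal to `h` is orthogonal to `x` (on the marked K3 `S_x`, `η⁻¹h` meets every
`(−2)`-class, i.e. lies in an open Weyl chamber: ample up to re-marking by `W(NS) × {±1}`, which fixes the
period), and no `Mδ′`, `δ′` a root with `Mδ′ ⊥ h`, is orthogonal to `x` (the same for the partner `S′_{x′}`,
`x′ ∝ N x`, `h′ ∝ N h`: `(δ′.Nx) = ½(Mδ′.x)`, `(δ′.Nh) = ½(Mδ′.h)`). Off the walls both universal families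
are PROJECTIVE (relatively ample `h`, `h′`) — the setting of BKP Thm 1.13 verbatim. -/
local notation3 (prettyPrint := false) "OffWall[" M ", " h ", " x "]" =>
  ((∀ δ : K3Index → ℤ, ∑ i, ∑ j, δ i * k3Gram i j * δ j = -2 →
      ∑ i, ∑ j, δ i * k3Gram i j * (h : K3Index → ℤ) j = 0 → k3Form (fun i => (δ i : ℂ)) x ≠ 0) ∧
    (∀ δ : K3Index → ℤ, ∑ i, ∑ j, δ i * k3Gram i j * δ j = -2 →
      k3Form ((M : Module.End ℂ (K3Index → ℂ)) (fun i => (δ i : ℂ))) (fun i => ((h : K3Index → ℤ) i : ℂ)) = 0 →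
      k3Form ((M : Module.End ℂ (K3Index → ℂ)) (fun i => (δ i : ℂ))) x ≠ 0))

/-! ### Off-wall points exist in every polarised period domain -/

/-- **Off-wall points exist**: every `D_h` (`h² > 0`) contains a point off every wall of the
`h`-polarised `M`-twin family, for every rational lattice `2`-similitude `(M, N)`. Construction
(Huybrechts Ch. 7 §3.1 genericity trick, inside `h^⊥`): `a := n + ε g_h` with `n ⊥ h` positive,
`g_h` the projection to `h^⊥` of a vector `g` with `g^⊥ ∩ Λ = 0` (`exists_k3_genericVector`) and
`ε` outside a countable set and small; then no non-zero lattice vector orthogonal to `h` is orthogonal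
to `a`, and `(a.a) > 0`; complete by `b ⊥ a, h` with `(b.b) = (a.a)` inside a positive three-space;
`x₀ := a + ib ∈ D_h`. A root `δ ⊥ h, x₀` would be `0`; for a root `δ′` with `Mδ′ ⊥ h, x₀`, the
lattice vector `d·Mδ′` (`d` a common denominator of `M`) would be `0`, so `δ′ = N M δ′ = 0`.
[cite: Huybrechts2016K3, Ch. 7 §3.1 and Ch. 6 Rem. 1.6] -/
theorem exists_offWall_mem_polarisedPeriodDomain :
    ∀ (M N : Module.End ℂ (K3Index → ℂ)), Latt[M, N] →
      ∀ (h : K3Index → ℤ), 0 < ∑ i, ∑ j, h i * k3Gram i j * h j →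
        ∃ x₀ ∈ polarisedPeriodDomain h, OffWall[M, h, x₀] := by
  classical
  intro M N hlatt h hh
  obtain ⟨hMrat, -, -, hNM, -⟩ := hlatt
  set B : LinearMap.BilinForm ℝ (K3Index → ℝ) := Matrix.toBilin' (k3Gram.map (Int.cast : ℤ → ℝ))
    with hB
  have hBs : ∀ u w, B u w = B w u := k3RForm_comm
  set hr : K3Index → ℝ := fun i => (h i : ℝ) with hhr
  have hhr_pos : 0 < B hr hr := by
    rw [hhr, k3RForm_intCast]; exact_mod_cast hh
  -- a positive triple, a positive `n ⊥ h`, a generic vector projected to `h^⊥`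
  obtain ⟨t, ht, -⟩ := exists_k3_generic_posFamily hB
  obtain ⟨n, -, hnh, -, hn⟩ := twistorChain_exists_orthogonal_mem_span B t ht hr hr
  obtain ⟨g, hg⟩ := exists_k3_genericVector
  set gh : K3Index → ℝ := g - (B g hr / B hr hr) • hr with hgh
  have hgh_h : B gh hr = 0 := by
    rw [hgh, LinearMap.BilinForm.sub_left, LinearMap.BilinForm.smul_left,
      div_mul_cancel₀ _ hhr_pos.ne', sub_self]
  have hgh_gen : ∀ v : K3Index → ℤ, B (fun i => (v i : ℝ)) hr = 0 →
      B (fun i => (v i : ℝ)) gh = 0 → v = 0 := by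
    intro v hvh hvg
    apply hg v
    rw [hgh, LinearMap.BilinForm.sub_right, LinearMap.BilinForm.smul_right, hvh,
      mul_zero, sub_zero] at hvg
    exact hvg
  -- the admissible `ε`: small, and outside the countable bad set
  set K : ℝ := 2 * |B n gh| + |B gh gh| + 1 with hK
  have hK0 : 0 < K := by positivity
  have hδ0 : 0 < min 1 (B n n / K) := lt_min one_pos (div_pos hn hK0)
  set C : Set ℝ := Set.range fun v : K3Index → ℤ =>
      -B (fun i => (v i : ℝ)) n / B (fun i => (v i : ℝ)) gh with hC
  have hCc : C.Countable := Set.countable_range _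
  obtain ⟨ε, ⟨hε0, hεδ⟩, hεC⟩ := exists_mem_Ioo_notMem_of_countable hCc hδ0
  set a : K3Index → ℝ := n + ε • gh with ha
  have hah : B a hr = 0 := by
    rw [ha, LinearMap.BilinForm.add_left, LinearMap.BilinForm.smul_left, hnh, hgh_h,
      mul_zero, add_zero]
  have ha_gen : ∀ v : K3Index → ℤ, B (fun i => (v i : ℝ)) hr = 0 →
      B (fun i => (v i : ℝ)) a = 0 → v = 0 := by
    intro v hvh hva
    by_contra hv0
    have hvg : B (fun i => (v i : ℝ)) gh ≠ 0 := fun h0 => hv0 (hgh_gen v hvh h0)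
    rw [ha, LinearMap.BilinForm.add_right, LinearMap.BilinForm.smul_right] at hva
    exact hεC ⟨v, by rw [div_eq_iff hvg]; linarith⟩
  have ha_pos : 0 < B a a := by
    have hε1 : ε ≤ 1 := hεδ.le.trans (min_le_left _ _)
    have hεK : ε * K < B n n := by
      have : ε < B n n / K := hεδ.trans_le (min_le_right _ _)
      rwa [lt_div_iff₀ hK0] at this
    have hexp : B a a = B n n + 2 * ε * B n gh + ε * ε * B gh gh := by
      rw [ha, LinearMap.BilinForm.add_left, LinearMap.BilinForm.add_right,
        LinearMap.BilinForm.add_right, LinearMap.BilinForm.smul_left, LinearMap.BilinForm.smul_left,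
        LinearMap.BilinForm.smul_right, LinearMap.BilinForm.smul_right, hBs gh n]
      ring
    rw [hexp]
    have hεε : ε * ε ≤ ε := by nlinarith
    have hQ1 : -(ε * |B n gh|) ≤ ε * B n gh := by
      have := mul_le_mul_of_nonneg_left (neg_abs_le (B n gh)) hε0.le
      linarith
    have hR1 : -(ε * ε * |B gh gh|) ≤ ε * ε * B gh gh := by
      have := mul_le_mul_of_nonneg_left (neg_abs_le (B gh gh)) (mul_self_nonneg ε)
      linarith
    have hR2 : ε * ε * |B gh gh| ≤ ε * |B gh gh| :=
      mul_le_mul_of_nonneg_right hεε (abs_nonneg _)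
    have hexpK : ε * K = 2 * (ε * |B n gh|) + ε * |B gh gh| + ε := by rw [hK]; ring
    linarith
  -- complete `a` to a conformal orthogonal pair inside `h^⊥`
  obtain ⟨m, -, hmh, hma, hm⟩ := twistorChain_exists_orthogonal_mem_span B t ht hr a
  set s : ℝ := Real.sqrt (B a a / B m m) with hs
  set b : K3Index → ℝ := s • m with hb
  have hab : B a b = 0 := by
    rw [hb, LinearMap.BilinForm.smul_right, hBs a m, hma, mul_zero]
  have hbb : B a a = B b b := by
    rw [hb, LinearMap.BilinForm.smul_left, LinearMap.BilinForm.smul_right,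
      ← mul_assoc, Real.mul_self_sqrt (div_nonneg ha_pos.le hm.le), div_mul_cancel₀ _ hm.ne']
  have hha : B hr a = 0 := by rw [hBs, hah]
  have hhb : B hr b = 0 := by
    rw [hb, LinearMap.BilinForm.smul_right, hBs hr m, hmh, mul_zero]
  set x₀ : K3Index → ℂ := fun i => (a i : ℂ) + (b i : ℂ) * Complex.I with hx₀
  have hx₀D : x₀ ∈ polarisedPeriodDomain h := polarisedPeriod_mk_mem hB hab hbb ha_pos hha hhb
  have hre : (fun j => (x₀ j).re) = a := by funext j; simp [hx₀]
  -- genericity of `x₀` against lattice vectors orthogonal to `h`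
  have hx_gen : ∀ v : K3Index → ℤ, B (fun i => (v i : ℝ)) hr = 0 →
      k3Form (fun i => (v i : ℂ)) x₀ = 0 → v = 0 := by
    intro v hvh hvx
    have hvC : (fun i => (v i : ℂ)) = fun i => (((v i : ℝ) : ℝ) : ℂ) := by funext i; simp
    rw [hvC] at hvx
    obtain ⟨hva, -⟩ := k3Real_orthogonal_re_im hvx
    rw [hre, ← hB] at hva
    exact ha_gen v hvh hva
  refine ⟨x₀, hx₀D, ?_, ?_⟩
  · -- first wall family: integral roots orthogonal to `h`
    intro δ hδ hδh hδx
    have hδhr : B (fun i => (δ i : ℝ)) hr = 0 := by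
      rw [hhr, k3RForm_intCast, hδh, Int.cast_zero]
    have hδ0 : δ = 0 := hx_gen δ hδhr hδx
    rw [hδ0] at hδ
    simp at hδ
  · -- second wall family: `Mδ′` with `δ′` a root
    intro δ hδ hMh hMx
    obtain ⟨d, hd0, hd⟩ := twinLatt_exists_common_denominator M hMrat
    obtain ⟨mv, hmv⟩ := hd δ
    have hdR : (d : ℝ) ≠ 0 := by exact_mod_cast hd0
    -- `M δ = (1/d) · mv`, `mv` integral
    have hscale : (fun i => ((((mv i : ℝ) / (d : ℝ) : ℝ)) : ℂ)) =
        ((1 / (d : ℝ) : ℝ) : ℂ) • fun i => ((mv i : ℤ) : ℂ) := by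
      funext i
      simp only [Pi.smul_apply, smul_eq_mul]
      push_cast
      ring
    rw [hmv, hscale, k3Form_smul_left, mul_eq_zero] at hMh hMx
    have hc0 : (((1 / (d : ℝ) : ℝ)) : ℂ) ≠ 0 := by
      exact_mod_cast one_div_ne_zero hdR
    have hMh' := hMh.resolve_left hc0
    have hMx' := hMx.resolve_left hc0
    have hmvh : B (fun i => (mv i : ℝ)) hr = 0 := by
      have hhC : (fun i => (h i : ℂ)) = fun i => (((h i : ℝ) : ℝ) : ℂ) := by funext i; simp
      have hmC : (fun i => ((mv i : ℤ) : ℂ)) = fun i => (((mv i : ℝ) : ℝ) : ℂ) := by funext i; simp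
      rw [hhC, hmC, k3Form_ofReal_eq_k3RForm] at hMh'
      rw [hhr]
      exact_mod_cast hMh'
    have hmv0 : mv = 0 := hx_gen mv hmvh hMx'
    have hMδ0 : M (fun i => (δ i : ℂ)) = 0 := by
      rw [hmv]; funext i; simp [hmv0]
    have hδC0 : (fun i => (δ i : ℂ)) = 0 := by
      have := congrArg N hMδ0
      rwa [← Module.End.mul_apply, hNM, Module.End.one_apply, map_zero] at this
    have hδ0 : δ = 0 := by
      funext i
      have := congrFun hδC0 i
      simp only [Pi.zero_apply, Int.cast_eq_zero] at this
      exact this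
    rw [hδ0] at hδ
    simp at hδ

/-! ### Twin transport gives a good pair at every polarised period -/

/-- A rational `2`-similitude `M` with two-sided inverse `N` makes `N` a `½`-similitude:
`(Na.Nb) = ½ (a.b)`. [folklore] -/
theorem k3Form_inv_of_latt {M N : Module.End ℂ (K3Index → ℂ)} (hMN : M * N = 1)
    (hM2 : ∀ a b, k3Form (M a) (M b) = 2 * k3Form a b) (a b : K3Index → ℂ) :
    k3Form (N a) (N b) = ((1 / 2 : ℚ) : ℂ) * k3Form a b := by
  have h := hM2 (N a) (N b)
  rw [← Module.End.mul_apply, ← Module.End.mul_apply, hMN, Module.End.one_apply,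
    Module.End.one_apply] at h
  rw [h]
  push_cast
  ring

/-- **Twin transport gives goodness at every polarised period.** Granted the surjectivity of the
period map (`K3PeriodSurjective`, route crux), for a rational lattice `2`-similitude `(M, N)` with
`TwinTransportFor[M]`, every `x ∈ D_h` (`h² > 0`) carries a good marked `M`-twin pair: realise `x` by a
marked projective K3 surface (period surjectivity; `PeriodPt[x]` from `h`), realise the twin period
`N x` likewise (`periodPt_simil`: `N` is a rational `½`-similitude), note `M (N x) = x`, and apply the
transport. [cite: Huybrechts2016K3, Ch. 6 Thm. 3.1 / Rem. 3.3 and Ch. 7 Thm. 4.1] -/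
theorem goodPairAt_of_twinTransport :
    K3PeriodSurjective → ∀ (M N : Module.End ℂ (K3Index → ℂ)), Latt[M, N] → TwinTransportFor[M] →
      ∀ (μ : OrientationFamily), μ.HasPoincareDuality →
        ∀ (h : K3Index → ℤ), 0 < ∑ i, ∑ j, h i * k3Gram i j * h j →
          ∀ x ∈ polarisedPeriodDomain h, GoodPairAt[M, μ, x] := by
  intro hP M N hlatt htw μ hμ h hh x hx
  obtain ⟨-, hNrat, hMN, -, hM2⟩ := hlatt
  have hxP : PeriodPt[x] := periodPt_of_mem_polarisedPeriodDomain hh hx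
  have hNxP : PeriodPt[N x] :=
    periodPt_simil N hNrat (1 / 2) (by norm_num) (k3Form_inv_of_latt hMN hM2) hxP
  obtain ⟨S, hS, η, p, hm⟩ := hP x hxP.1 hxP.2.1 hxP.2.2
  obtain ⟨S', hS', η', p', hm'⟩ := hP (N x) hNxP.1 hNxP.2.1 hNxP.2.2
  have hper : ∃ t : ℂ, M (N x) = t • x :=
    ⟨1, by rw [← Module.End.mul_apply, hMN, Module.End.one_apply, one_smul]⟩
  obtain ⟨γ, hγ, hγeq⟩ := htw μ hμ S S' hS hS' η p x η' p' (N x) hm hxP hm' hNxP hper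
  exact ⟨S, S', hS, hS', η, p, η', p', N x, hm, hxP, hm', hNxP, hper, γ, hγ, hγeq⟩

end Summit.HodgeConjecture.HodgeConjecture.Theorems.NikulinTwinTransport

end
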